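import Literature.NumberTheory.EllipticCurves.HeegnerPointsRationalityProofs
import Literature.NumberTheory.EllipticCurves.HeegnerPointsTrustBaseRationalityProofs
import Literature.NumberTheory.EllipticCurves.PeriodLatticeRationalityUnconditionalProofs
import Literature.NumberTheory.EllipticCurves.HeegnerPointReflectionHolds
import HarnessLib

/-!
# `exists_isHeegnerPoint` is the Modularity leaf: unconditionally,
# `(∀ W K, exists_isHeegnerPoint W K) ↔ nonempty_modularParametrizationData`

Topic `NumberTheory/EllipticCurves`; a proofs-only companion (theorems only: no definitions, no
named facts, nothing restated; D-0026) of `HeegnerPoints.lean`, written by the seat of its named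
fact `Literature.NumberTheory.EllipticCurves.exists_isHeegnerPoint W K` (Gross–Zagier 1986, I.§4;
Gross 1991, §1; Darmon 2004, §3.7): for `W/ℚ` a globally minimal elliptic curve of conductor `N_E`
and `K` imaginary quadratic satisfying the Heegner hypothesis for `N_E`, some `P ∈ E(K)` is a
Heegner point of level `N_E`, i.e. `ι(P) = ∑_{[Q]} φ(τ_Q) = Tr_{H/K} φ(τ_1)` for a modular
parametrisation datum at level `N_E`, a Heegner datum of discriminant `d_K` and an embedding `ι`.

State of the tree.  The fact was reduced (`HeegnerPointsRationality`, `HeegnerPointsGaloisDescent`,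
`HeegnerPointsShimuraReduction`, `HeegnerPointsTrustBaseRationalityProofs`) to the Modularity leaf
`nonempty_modularParametrizationData` (Breuil–Conrad–Diamond–Taylor 2001, Thm. A in the analytic
form (6) of p. 845) and the `ℚ`-rationality of the parametrisation `φ` at the CM points in
transport form (`ModularParametrizationData.IsAutEquivariantOnHeegner`, proof of Darmon's Thm. 3.6).
The latter is now a **theorem of the tree for every datum**
(`ModularParametrizationData.isAutEquivariantOnHeegner`, `HeegnerPointsRationalityProofs.lean`,
closing the "canonical model of `X₀(N)` at CM points" chain), with it leaf 4
(`heegnerPointComplex_mem_range_map_holds`, Darmon Thm. 3.6–3.7 and §3.7).  This file records what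
that leaves of the fact — nothing but modularity:

* `ModularParametrizationData.nonempty_of_isNewformOf`, `…nonempty_iff_exists_isNewformOf` —
  per curve and level, a parametrisation datum is *exactly* a newform `f` of `W`
  (`IsNewformOf W f`), a Néron-type period pair `L` and an integer `c ≠ 0` with `c Λ_f ⊆ Λ_L`:
  the uniformisation (`IsNeronLatticeOf.exists_uniformize_holds`, Silverman AEC VI.3.6 (b)) and
  the modular degree (`exists_modularDegree_holds`) are theorems of the tree.
* `exists_isHeegnerPoint_of_modularParametrizationData`, `exists_isHeegnerPoint_of_nonempty`,
  `exists_isHeegnerPoint_iff_nonempty`, `exists_isHeegnerPoint_of_isNewformOf` — **per curve,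
  unconditionally: `exists_isHeegnerPoint W K` follows from ONE modular parametrisation datum of
  `W` at level `N_E`** (equivalently: a newform of level `N_E` for `W` with a nonzero integral
  multiplier into a Néron-type lattice), and conversely a Heegner point carries its datum; so the
  fact for `W, K` is equivalent to "under its binders, `W` has a datum at level `N_E`".
* `exists_isHeegnerPoint_of_nonempty_modularParametrizationData` (BCDT's (6) alone ⊢ the fact),
  `exists_isHeegnerPoint_of_exists_isNewformOf_of_maninConstant` ((2) `exists_isNewformOf` and
  the rational Manin constant `IsNewformOf.exists_maninConstant_ne_zero`),
  `exists_isHeegnerPoint_of_congruenceRelation` ((2), the Eichler–Shimura congruence relation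
  `a_p(f) = a_p(ℂ/Λ_f)` for `p ∤ N` — Shimura 1971, Thm. 7.15; Knapp 1993, Thm. 11.74 (e) — and
  Faltings' isogeny theorem `isIsogenous_iff_frobeniusTrace_eq`, through the tree's
  `nonempty_modularParametrizationData_of_congruenceRelation`).
* `forall_exists_isHeegnerPoint_iff`, `forall_exists_isHeegnerPoint_iff_nonempty_modularParametrizationData`,
  `forall_exists_isHeegnerPoint_iff_exists_maninConstant_ne_zero` — **unconditionally,
  `(∀ W K, exists_isHeegnerPoint W K) ↔ exists_isNewformOf ∧ IsNewformOf.exists_maninConstant_ne_zero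
  ↔ nonempty_modularParametrizationData`**, and, granted (2), `↔` the Manin-constant statement
  alone (`→`: Heegner fields exist at every level by Dirichlet's theorem and a Heegner point
  carries its datum, `nonempty_modularParametrizationData_of_forall_exists_isHeegnerPoint`).  So the
  open content of the fact is *exactly* that of BCDT's Theorem A in form (6): the discharge
  `exists_isHeegnerPoint_holds` is provably not available before `exists_isNewformOf_holds`
  (the Modularity Theorem) and is one line after `nonempty_modularParametrizationData_holds`.
* `rank_eq_analyticRank_of_analyticRank_le_one_of_modularity_of_maninConstant`,
  `rank_eq_analyticRank_of_analyticRank_le_one_of_nonempty_modularParametrizationData` — the BSD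
  rank-`≤ 1` assembly (Darmon 2004, Thm. 3.22; `rank_eq_analyticRank_of_analyticRank_le_one_of_modularity''`,
  `HeegnerPointReflectionHolds.lean`) with its hypothesis `hHP : ∀ W K, exists_isHeegnerPoint W K`
  **eliminated**: from modularity in form (6) (or `existsUnique_isNewformOf` with the Manin
  constant), Waldspurger, Murty–Murty, Gross–Zagier and Kolyvagin — five named inputs.

Nothing is discharged here; no statement of the tree is changed; no definition and no named fact
is added.

## References

* B. H. Gross, D. B. Zagier, *Heegner points and derivatives of `L`-series*, Invent. Math. 84
  (1986), 225–320, I.§4. [GrossZagier1986]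
* B. H. Gross, *Kolyvagin's work on modular elliptic curves*, LMS Lecture Note Ser. 153 (1991),
  235–256, §1 (pp. 235–236). [GrossLMS1991]
* H. Darmon, *Rational points on modular elliptic curves*, CBMS 101, AMS 2004, Thm. 3.6 and its
  proof (PDF p. 43), Thm. 3.7 (PDF p. 44), §3.7 (PDF p. 49), Thm. 3.22 and §3.9. [Darmon2004]
* C. Breuil, B. Conrad, F. Diamond, R. Taylor, *On the modularity of elliptic curves over `ℚ`: wild
  3-adic exercises*, J. Amer. Math. Soc. 14 (2001), 843–939, Theorem A; p. 845, (1)–(6) and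
  "(2) ⇒ (6)". [BCDTJAMS2001]
* G. Shimura, *Introduction to the arithmetic theory of automorphic functions*, Princeton 1971,
  Thm. 7.14, Thm. 7.15. [ShimuraIATAF1971]
* A. W. Knapp, *Elliptic Curves*, Princeton 1993, Thm. 11.74 and Remarks, Thm. 12.8. [Knapp1993]
-/

noncomputable section

open scoped Classical MatrixGroups ModularForm

universe u

namespace Literature.NumberTheory.EllipticCurves

open ModularForms NumberField CongruenceSubgroup UpperHalfPlane ModularFormClass

/-! ### A modular parametrisation datum from a newform and a Manin constant (per curve) -/

namespace ModularForms.ModularParametrizationData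

variable {W : WeierstrassCurve ℚ} {N : ℕ} [NeZero N]

/-- **A parametrisation datum of `W` at level `N` from a newform and a Manin constant.**  If
`f ∈ S₂(Γ₀(N))` is the newform of the elliptic curve `W/ℚ` (`IsNewformOf W f`), `L` a period pair
with `g₂(L) = c₄/12`, `g₃(L) = c₆/216` (`IsNeronLatticeOf`), and `c ≠ 0` an integer with
`c Λ_f ⊆ Λ_L`, then `W` has a `ModularParametrizationData W N` with these `f, L, c`: the complex
uniformisation `ℂ →+ E(ℂ)` with kernel `Λ_L` is `IsNeronLatticeOf.exists_uniformize_holds`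
(Silverman AEC VI.3.6 (b)) and the degree of `Γ₀(N)τ ↦ c · 2πi∫_{i∞}^τ f (mod Λ_L)` is
`exists_modularDegree_holds` (Riemann-surface theory of `X₀(N)`), transported to `E(ℂ)` along
`ℂ/Λ_L ≃ E(ℂ)` (`finite_setOf_card_fiberOrbits_ne_iff`) — the per-curve form of the tree's
`nonempty_modularParametrizationData_of`. [cite: BCDTJAMS2001, Thm. A with (6) of p. 845] -/
theorem nonempty_of_isNewformOf [W.IsElliptic] {f : CuspForm (Gamma0 N) 2} (hf : IsNewformOf W f)
    {L : PeriodPair} (hL : IsNeronLatticeOf (W.baseChange ℂ) L) {c : ℤ} (hc0 : c ≠ 0)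
    (hc : ∀ z ∈ periodLattice f, (c : ℂ) * z ∈ L.lattice) :
    Nonempty (ModularParametrizationData W N) := by
  haveI : (W.baseChange ℂ).IsElliptic := by rw [WeierstrassCurve.baseChange]; infer_instance
  obtain ⟨u, hker, hsurj, hspec⟩ := IsNeronLatticeOf.exists_uniformize_holds hL
  obtain ⟨d, hd, hfin⟩ := exists_modularDegree_holds hf.1.ne_zero (L := L) (c := (c : ℂ))
    (Int.cast_ne_zero.mpr hc0) hc
  -- transport the exceptional set along `ℂ/Λ_L ≃ E(ℂ)`
  have hker' : L.lattice.toAddSubgroup = u.ker :=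
    SetLike.coe_injective (by rw [Submodule.coe_toAddSubgroup, hker])
  let e : ℂ ⧸ L.lattice.toAddSubgroup ≃+ (W.baseChange ℂ).toAffine.Point :=
    QuotientAddGroup.liftEquiv L.lattice.toAddSubgroup hsurj hker'
  have he : ∀ x : ℂ, e.toEquiv (x : ℂ ⧸ L.lattice.toAddSubgroup) = u x := fun _ ↦ rfl
  have key := (finite_setOf_card_fiberOrbits_ne_iff e.toEquiv
    (fun τ : ℍ ↦ (((c : ℂ) * eichlerIntegral f τ : ℂ) : ℂ ⧸ L.lattice.toAddSubgroup)) d).mpr hfin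
  simp only [he] at key
  exact ⟨{ f := f
           isNewformOf := hf
           L := L
           isNeronLattice := hL
           uniformize := u
           ker_uniformize := hker
           uniformize_surjective := hsurj
           uniformize_spec := hspec
           c := c
           smul_periodLattice_le := hc
           deg := d
           deg_pos := hd
           deg_spec := key }⟩

/-- **Per curve and level, a parametrisation datum is exactly (newform, Néron-type pair, nonzero
integral multiplier).**  `Nonempty (ModularParametrizationData W N)` iff there are a newform
`f ∈ S₂(Γ₀(N))` of `W`, a period pair `L` with `IsNeronLatticeOf (W.baseChange ℂ) L` and an
integer `c ≠ 0` with `c Λ_f ⊆ Λ_L` (`→`: the datum's own `f, L, c`, `c ≠ 0` by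
`maninConstant_ne_zero_holds`; `←`: `nonempty_of_isNewformOf`) — the per-curve form of the tree's
`nonempty_modularParametrizationData_iff`. [cite: BCDTJAMS2001, Thm. A with (6) of p. 845] -/
theorem nonempty_iff_exists_isNewformOf [W.IsElliptic] :
    Nonempty (ModularParametrizationData W N) ↔
      ∃ f : CuspForm (Gamma0 N) 2, IsNewformOf W f ∧ ∃ L : PeriodPair,
        IsNeronLatticeOf (W.baseChange ℂ) L ∧
          ∃ c : ℤ, c ≠ 0 ∧ ∀ z ∈ periodLattice f, (c : ℂ) * z ∈ L.lattice := by
  refine ⟨fun ⟨D⟩ ↦ ⟨D.f, D.isNewformOf, D.L, D.isNeronLattice, D.exists_maninConstant_ne_zero⟩,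
    fun ⟨_, hf, _, hL, _, hc0, hc⟩ ↦ nonempty_of_isNewformOf hf hL hc0 hc⟩

end ModularForms.ModularParametrizationData

/-! ### Per curve: the fact from one datum at level `N_E`, unconditionally -/

section PerCurve

variable {W : WeierstrassCurve ℚ} {K : Type u} [Field K] [NumberField K]

/-- **`exists_isHeegnerPoint W K` from parametrisation data at level `N_E`, unconditionally**
("`P_K = Trace_{H/K} P_1 ∈ E(K)`", Darmon 2004, §3.7; Gross 1991, §1).  If — for `W` elliptic and
globally minimal with `N_E ≠ 0`, and `K` imaginary quadratic satisfying the Heegner hypothesis for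
`N_E` — `W` admits a modular parametrisation datum at level `N_E`, then some `P ∈ E(K)` is a Heegner
point of level `N_E`.  The `ℚ`-rationality of `φ` at the CM points
(`ModularParametrizationData.isAutEquivariantOnHeegner`), Darmon's Thms. 3.6–3.7 over the field of
singular moduli and the Galois descent of the trace are theorems of the tree
(`exists_isHeegnerPoint_of_exists_isAutEquivariantOnHeegner`). [cite: Darmon2004, §3.7 (PDF p. 49)] -/
theorem exists_isHeegnerPoint_of_nonempty
    (h : ∀ [W.IsElliptic] [W.IsGloballyMinimal] [NeZero (W.conductorNorm ℤ)],
      IsImaginaryQuadratic K → SatisfiesHeegnerHypothesis (W.conductorNorm ℤ) K →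
      Nonempty (ModularParametrizationData W (W.conductorNorm ℤ))) :
    exists_isHeegnerPoint W K :=
  exists_isHeegnerPoint_of_exists_isAutEquivariantOnHeegner fun hK hH ↦ by
    obtain ⟨Dt⟩ := h hK hH
    exact ⟨Dt, Dt.isAutEquivariantOnHeegner _⟩

/-- **`exists_isHeegnerPoint W K` from ONE modular parametrisation datum of `W` at level `N_E`**
(any newform/lattice/Manin constant; no hypothesis on `K` beyond the binders of the fact): the trace
to `K` of `φ(τ_1)` over a Heegner datum of discriminant `d_K` is a `K`-rational Heegner point
(Gross 1991, §1: "`y_K = Tr_{K_1/K}(y_1)` in `E(K)`"). [cite: GrossLMS1991, §1 (pp. 235–236)] -/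
theorem exists_isHeegnerPoint_of_modularParametrizationData [NeZero (W.conductorNorm ℤ)]
    (Dt : ModularParametrizationData W (W.conductorNorm ℤ)) : exists_isHeegnerPoint W K :=
  exists_isHeegnerPoint_of_nonempty fun _ _ ↦ ⟨Dt⟩

/-- **Per curve, unconditionally, the fact is the modularity of `W`**: `exists_isHeegnerPoint W K`
holds iff, under its binders (`W` elliptic, globally minimal, `N_E ≠ 0`, `K` imaginary quadratic
with the Heegner hypothesis for `N_E`), `W` admits a modular parametrisation datum at level `N_E`
(`→`: a Heegner point carries its datum, `nonempty_modularParametrizationData_of_exists_isHeegnerPoint`;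
`←`: `exists_isHeegnerPoint_of_nonempty`). [cite: Darmon2004, Thm. 3.6 and §3.7] -/
theorem exists_isHeegnerPoint_iff_nonempty :
    exists_isHeegnerPoint W K ↔
      ∀ [W.IsElliptic] [W.IsGloballyMinimal] [NeZero (W.conductorNorm ℤ)],
        IsImaginaryQuadratic K → SatisfiesHeegnerHypothesis (W.conductorNorm ℤ) K →
        Nonempty (ModularParametrizationData W (W.conductorNorm ℤ)) :=
  exists_isHeegnerPoint_iff_of_isAutEquivariantOnHeegner fun Dt _ _ ↦ Dt.isAutEquivariantOnHeegner _

/-- **`exists_isHeegnerPoint W K` from a newform of level `N_E` and a Manin constant**: if `W/ℚ`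
is elliptic with newform `f ∈ S₂(Γ₀(N_E))` (`IsNewformOf W f`: `aₙ(f) = aₙ(W)`), `L` is a period
pair with `IsNeronLatticeOf (W.baseChange ℂ) L` and `c ≠ 0` an integer with `c Λ_f ⊆ Λ_L` ("let
`Φ_N : X₀(N) → E` be a modular parametrisation", `Φ_N^* ω = c · 2πi f(τ)dτ`), then the Heegner
point over every Heegner field `K` for `N_E` is `K`-rational
(`ModularParametrizationData.nonempty_of_isNewformOf` and
`exists_isHeegnerPoint_of_modularParametrizationData`). [cite: GrossLMS1991, §1 (pp. 235–236)] -/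
theorem exists_isHeegnerPoint_of_isNewformOf [W.IsElliptic] [NeZero (W.conductorNorm ℤ)]
    {f : CuspForm (Gamma0 (W.conductorNorm ℤ)) 2} (hf : IsNewformOf W f) {L : PeriodPair}
    (hL : IsNeronLatticeOf (W.baseChange ℂ) L) {c : ℤ} (hc0 : c ≠ 0)
    (hc : ∀ z ∈ periodLattice f, (c : ℂ) * z ∈ L.lattice) :
    exists_isHeegnerPoint W K := by
  obtain ⟨Dt⟩ := ModularParametrizationData.nonempty_of_isNewformOf hf hL hc0 hc
  exact exists_isHeegnerPoint_of_modularParametrizationData Dt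

end PerCurve

/-! ### The fact from the Modularity leaf, and the unconditional equivalences -/

section Global

variable (W : WeierstrassCurve ℚ) (K : Type u) [Field K] [NumberField K]

/-- **`exists_isHeegnerPoint W K` from BCDT's (6) alone**: granted `nonempty_modularParametrizationData`
(every elliptic curve over `ℚ`, in a globally minimal model, admits a modular parametrisation datum at
level `N_E`: Breuil–Conrad–Diamond–Taylor 2001, Thm. A in form (6)), the Heegner point over every
Heegner field is `K`-rational (Gross–Zagier 1986, I.§4; Darmon 2004, §3.7) — the tree's
`exists_isHeegnerPoint_of_modularity_of_isAutEquivariantOnHeegner` with its second hypothesis now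
proved (`ModularParametrizationData.isAutEquivariantOnHeegner`). [cite: GrossZagier1986, I.§4] -/
theorem exists_isHeegnerPoint_of_nonempty_modularParametrizationData
    (h₁ : nonempty_modularParametrizationData) : exists_isHeegnerPoint W K :=
  exists_isHeegnerPoint_of_nonempty fun _ _ ↦ h₁ W

/-- **`exists_isHeegnerPoint W K` from the Modularity Theorem (2) and the rational Manin constant**:
`exists_isNewformOf` (BCDT 2001, Thm. A (2): a newform of level `N_E` with `aₙ(f) = aₙ(E)`) and
`IsNewformOf.exists_maninConstant_ne_zero` (`c Λ_f ⊆ Λ_E`, `c ∈ ℤ ∖ {0}`: "(2) ⇒ (6) by a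
construction of Shimura and a theorem of Faltings", p. 845) give (6)
(`nonempty_modularParametrizationData_of_exists_isNewformOf`), whence the fact.
[cite: BCDTJAMS2001, Thm. A with p. 845, "(2) ⇒ (6)"] -/
theorem exists_isHeegnerPoint_of_exists_isNewformOf_of_maninConstant (h₁ : exists_isNewformOf)
    (ha : IsNewformOf.exists_maninConstant_ne_zero) : exists_isHeegnerPoint W K :=
  exists_isHeegnerPoint_of_nonempty_modularParametrizationData W K
    (nonempty_modularParametrizationData_of_exists_isNewformOf h₁ ha)

/-- **`exists_isHeegnerPoint W K` from the Modularity Theorem, the Eichler–Shimura congruence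
relation and Faltings' isogeny theorem** — the finest hypothesis set currently available in the
tree: `exists_isNewformOf` (BCDT Thm. A (2)); for every rational newform `f ∈ S₂(Γ₀(N))` and the
model `y² = x³ + a₄x + a₆`, `(-4a₄, -4a₆) = (g₂(Λ_f), g₃(Λ_f))`, of `ℂ/Λ_f` the congruence relation
`a_p(f) = a_p(ℂ/Λ_f)` at the primes `p ∤ N` (Shimura 1971, Thm. 7.15; Knapp 1993, Thm. 11.74 (e));
and `isIsogenous_iff_frobeniusTrace_eq` (Faltings 1983) — through the tree's
`nonempty_modularParametrizationData_of_congruenceRelation` (the rationality of `g₂(Λ_f), g₃(Λ_f)`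
and the lattice bookkeeping being theorems). [cite: ShimuraIATAF1971, Thm. 7.14 and Thm. 7.15] -/
theorem exists_isHeegnerPoint_of_congruenceRelation (h₁ : exists_isNewformOf)
    (hC : ∀ (N : ℕ) [NeZero N] (f : CuspForm (Gamma0 N) 2), IsNewform0 f → coeffField f = ⊥ →
      ∀ (L : PeriodPair), L.lattice.toAddSubgroup = periodLattice f →
        ∀ a₄ a₆ : ℚ, L.g₂ = -4 * (a₄ : ℂ) → L.g₃ = -4 * (a₆ : ℂ) →
          ∀ p : ℕ, p.Prime → ¬ p ∣ N →
            (qExpansion 1 ⇑f).coeff p =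
              (({ a₁ := 0, a₂ := 0, a₃ := 0, a₄ := a₄, a₆ := a₆ } : WeierstrassCurve ℚ).LFunction
                p : ℂ))
    (hF : WeierstrassCurve.isIsogenous_iff_frobeniusTrace_eq) : exists_isHeegnerPoint W K :=
  exists_isHeegnerPoint_of_nonempty_modularParametrizationData W K
    (nonempty_modularParametrizationData_of_congruenceRelation h₁ hC hF)

/-- **Unconditionally, `∀ W K, exists_isHeegnerPoint W K` is equivalent to the Modularity Theorem
(2) together with the rational Manin constant**: `→` by
`nonempty_modularParametrizationData_of_forall_exists_isHeegnerPoint` (Heegner fields exist at every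
level by Dirichlet's theorem on primes in progressions, and a Heegner point carries its datum) and
`nonempty_modularParametrizationData_iff`; `←` by
`exists_isHeegnerPoint_of_exists_isNewformOf_of_maninConstant` — the tree's
`forall_exists_isHeegnerPoint_iff_of_isAutEquivariantOnHeegner` with its hypothesis proved.
[cite: BCDTJAMS2001, Thm. A with p. 845, "(2) ⇒ (6)"] -/
theorem forall_exists_isHeegnerPoint_iff :
    (∀ (W : WeierstrassCurve ℚ) (K : Type) [Field K] [NumberField K], exists_isHeegnerPoint W K) ↔
      exists_isNewformOf ∧ IsNewformOf.exists_maninConstant_ne_zero :=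
  forall_exists_isHeegnerPoint_iff_of_isAutEquivariantOnHeegner fun _ _ _ _ _ _ _ Dt _ _ ↦
    Dt.isAutEquivariantOnHeegner _

/-- **Unconditionally, `∀ W K, exists_isHeegnerPoint W K ↔ nonempty_modularParametrizationData`**
(BCDT's Theorem A in the analytic form (6)): the open content of the fact is exactly the Modularity
leaf. [cite: BCDTJAMS2001, Thm. A with (6) of p. 845] -/
theorem forall_exists_isHeegnerPoint_iff_nonempty_modularParametrizationData :
    (∀ (W : WeierstrassCurve ℚ) (K : Type) [Field K] [NumberField K], exists_isHeegnerPoint W K) ↔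
      nonempty_modularParametrizationData :=
  forall_exists_isHeegnerPoint_iff_nonempty_modularParametrizationData_of_isAutEquivariantOnHeegner
    fun _ _ _ _ _ _ _ Dt _ _ ↦ Dt.isAutEquivariantOnHeegner _

/-- **Granted the Modularity Theorem (2), `∀ W K, exists_isHeegnerPoint W K` is exactly the
rationality of the Manin constant** (`IsNewformOf.exists_maninConstant_ne_zero`: for every elliptic
`W/ℚ` with newform `f` and Néron-type pair `L`, some integer `c ≠ 0` has `c Λ_f ⊆ Λ_L`; "(2) ⇒ (6)",
BCDT p. 845, via Shimura's construction and Faltings), by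
`nonempty_modularParametrizationData_iff_exists_maninConstant_ne_zero`.
[cite: BCDTJAMS2001, p. 845, "(2) ⇒ (6)"] -/
theorem forall_exists_isHeegnerPoint_iff_exists_maninConstant_ne_zero (h₁ : exists_isNewformOf) :
    (∀ (W : WeierstrassCurve ℚ) (K : Type) [Field K] [NumberField K], exists_isHeegnerPoint W K) ↔
      IsNewformOf.exists_maninConstant_ne_zero := by
  rw [forall_exists_isHeegnerPoint_iff_nonempty_modularParametrizationData,
    nonempty_modularParametrizationData_iff_exists_maninConstant_ne_zero h₁]

end Global

/-! ### The BSD rank-`≤ 1` assembly without the hypothesis `hHP` -/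

section BSD

/-- **Darmon 2004, Thm. 3.22 (Gross–Zagier, Kolyvagin) with the `K`-rationality of the Heegner
point proved from modularity.**  The named fact `rank_eq_analyticRank_of_analyticRank_le_one`
(`ord_{s=1} L(E, s) ≤ 1 ⇒ rank E(ℚ) = ord_{s=1} L(E, s) ∧ #Ш(E/ℚ) < ∞`) from: modularity in
Version `L` (`hmod`, `existsUnique_isNewformOf`, BCDT 2001 Thm. A), the rational Manin constant
(`ha`, `IsNewformOf.exists_maninConstant_ne_zero`; with `hmod` this is BCDT's form (6)),
Waldspurger's and Murty–Murty's non-vanishing theorems for quadratic twists (`hWa`, `hMM`), the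
Gross–Zagier formula (`hGZ`) and Kolyvagin's theorem (`hKo`) — the tree's
`rank_eq_analyticRank_of_analyticRank_le_one_of_modularity''` with its hypothesis
`hHP : ∀ W K, exists_isHeegnerPoint W K` supplied by
`exists_isHeegnerPoint_of_exists_isNewformOf_of_maninConstant`. [cite: Darmon2004, Thm. 3.22 and §3.9] -/
theorem rank_eq_analyticRank_of_analyticRank_le_one_of_modularity_of_maninConstant
    (hmod : existsUnique_isNewformOf) (ha : IsNewformOf.exists_maninConstant_ne_zero)
    (hWa : waldspurger_exists_heegnerField_twist_ne_zero)
    (hMM : murtyMurty_exists_heegnerField_twist_simpleZero)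
    (hGZ : ∀ (N : ℕ) [NeZero N] (W : WeierstrassCurve ℚ) (K : Type) [Field K] [NumberField K],
      gross_zagier N W K)
    (hKo : ∀ (N : ℕ) [NeZero N] (W : WeierstrassCurve ℚ) (K : Type) [Field K] [NumberField K],
      kolyvagin N W K) :
    rank_eq_analyticRank_of_analyticRank_le_one :=
  rank_eq_analyticRank_of_analyticRank_le_one_of_modularity'' hmod hWa hMM hGZ
    (fun W K _ _ ↦ exists_isHeegnerPoint_of_exists_isNewformOf_of_maninConstant W K
      (exists_isNewformOf_of_existsUnique hmod) ha) hKo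

/-- **The BSD rank-`≤ 1` theorem from five named inputs**: BCDT's Theorem A in form (6)
(`nonempty_modularParametrizationData`; it gives Version `L` with uniqueness by strong multiplicity
one, `existsUnique_isNewformOf_iff`, and the Manin constant,
`exists_maninConstant_ne_zero_of_nonempty_modularParametrizationData`), Waldspurger, Murty–Murty,
Gross–Zagier and Kolyvagin. [cite: Darmon2004, Thm. 3.22 and §3.9] -/
theorem rank_eq_analyticRank_of_analyticRank_le_one_of_nonempty_modularParametrizationData
    (h₆ : nonempty_modularParametrizationData)
    (hWa : waldspurger_exists_heegnerField_twist_ne_zero)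
    (hMM : murtyMurty_exists_heegnerField_twist_simpleZero)
    (hGZ : ∀ (N : ℕ) [NeZero N] (W : WeierstrassCurve ℚ) (K : Type) [Field K] [NumberField K],
      gross_zagier N W K)
    (hKo : ∀ (N : ℕ) [NeZero N] (W : WeierstrassCurve ℚ) (K : Type) [Field K] [NumberField K],
      kolyvagin N W K) :
    rank_eq_analyticRank_of_analyticRank_le_one :=
  rank_eq_analyticRank_of_analyticRank_le_one_of_modularity''
    (existsUnique_isNewformOf_iff.mpr (exists_isNewformOf_of_nonempty_modularParametrizationData h₆))
    hWa hMM hGZ (fun W K _ _ ↦ exists_isHeegnerPoint_of_nonempty_modularParametrizationData W K h₆)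
    hKo

end BSD

end Literature.NumberTheory.EllipticCurves

end
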